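import Summits.NavierStokesRegularity.NavierStokesRegularity.Theorems.LocalSineTubeDoorProfileAlignedWindowRigidityAncient
import Literature.Analysis.FluidPDE.BlowupAncientSolution
import Literature.Analysis.FluidPDE.MildSolution
import HarnessLib

/-!
# Crux `ExtremiserTransience.NearExtremalTransience` (stmt-NavierStokesRegularity-21883), line `extremiser_liouville`,
# stub K1a `stub_analyticSlices` — slices of an Oseen-mild KNSS blow-up limit are real analytic (PROVED)

Author: prover seat `ns-el-k1b` (g4).  The registered stub K1a of `Cruxes/NearExtremalTransience/Lines/extremiser_liouville.lean`
(v1.3), VERBATIM: for every KNSS blow-up limit `W` (`IsKNSSBlowupLimit W`: a bounded ancient mild solution on `(-∞,0)`, smooth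
on the open slab, `‖W‖ ≤ 1`) which is Oseen-mild from every past time,
`W t x = heatFlow (W s) (t − s) x − oseenDuhamel 1 s W W t x` (`s < t < 0`), every negative-time slice `W t` is real analytic
on `ℝ³`.

Proof: ONE TERM over the tree theorem
`Summit…Theorems.LocalSineTubeDoorProfileAlignedWindowRigidityAncient.analyticOnNhd_slice` (joint real analyticity of
Oseen-mild ancient fields bounded on every `(-∞,-δ)`; underneath: Lemarié-Rieusset 2016, Thm 9.12 via
`Literature.Analysis.FluidPDE.lemarieRieusset2016_local_analyticity_holds`, and bounded-mild uniqueness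
`oseenMild_essBounded_unique`): continuity of `uncurry W` on the slab comes from `IsKNSSBlowupLimit.smooth`, the bound
`B = 1` on every `(-∞,-δ)` from `IsKNSSBlowupLimit.norm_le_one`, and `heatFlow (W s) (t − s) = heatExtension (W s) (t − s)`
for `s < t` (`heatFlow_of_pos`).  (The same mechanism landed for route `PoloidalWindowRigidity` as
`…PoloidalWindowDoorPoloidalWindowRigidityTypeIAnalytic.typeI_mild_slice_analytic` under a Type-I hypothesis; here the KNSS
bound `‖W‖ ≤ 1` replaces Type I.)

WHAT THIS IS NOT: K1b (`stub_noAnalyticExtremal`) and K2 remain open; nothing here proves NS regularity. [folklore]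
-/

noncomputable section

open Set Filter Topology MeasureTheory Function
open Literature.Analysis Literature.Analysis.FluidPDE Literature.Analysis.UnboundedOperators
open Summit.NavierStokesRegularity.NavierStokesRegularity.Theorems.LocalSineTubeDoorProfileAlignedWindowRigidityAncient

namespace Summit.NavierStokesRegularity.NavierStokesRegularity.Theorems

-- the problem directory repeats the summit name (`NavierStokesRegularity/NavierStokesRegularity`)
set_option linter.dupNamespace false

namespace ExtremiserLiouville

/-- **K1a · `stub_analyticSlices` (registered stub of crux stmt-NavierStokesRegularity-21883, line `extremiser_liouville`),
PROVED.**  Slices of a KNSS blow-up limit in the Oseen gauge are real analytic in space at every negative time: one term over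
`analyticOnNhd_slice` (Lemarié-Rieusset 2016 Thm 9.12 + bounded-mild uniqueness, tree theorems), with continuity from
`IsKNSSBlowupLimit.smooth`, the bound `‖W‖ ≤ 1` from `IsKNSSBlowupLimit.norm_le_one`, and `heatFlow = heatExtension` at
positive times (`heatFlow_of_pos`). [cite: LemarieRieusset2016, Thm 9.12] -/
theorem stub_analyticSlices :
    ∀ (W : ℝ → EuclideanSpace ℝ (Fin 3) → EuclideanSpace ℝ (Fin 3)), (Literature.Analysis.FluidPDE.IsKNSSBlowupLimit W ∧ (∀ s t : ℝ, s < t → t < 0 → ∀ x, W t x = Literature.Analysis.FluidPDE.heatFlow (W s) (t - s) x - Literature.Analysis.FluidPDE.oseenDuhamel 1 s W W t x)) → ∀ t : ℝ, t < 0 → AnalyticOnNhd ℝ (W t) Set.univ := by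
  rintro W ⟨hW, hmild⟩ t ht
  have hcont : ContinuousOn (uncurry W) (Iio (0 : ℝ) ×ˢ univ) := hW.smooth.continuousOn
  have hbdd : ∀ δ : ℝ, 0 < δ → ∃ B : ℝ, ∀ t < -δ, ∀ y : EuclideanSpace ℝ (Fin 3), ‖W t y‖ ≤ B :=
    fun δ hδ => ⟨1, fun t ht y => hW.norm_le_one t (by linarith) y⟩
  have hmild' : ∀ s t : ℝ, s < t → t < 0 → ∀ y : EuclideanSpace ℝ (Fin 3),
      W t y = UnboundedOperators.heatExtension (W s) (t - s) y - oseenDuhamel 1 s W W t y := by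
    intro s t hst ht y
    rw [← heatFlow_of_pos (W s) (sub_pos.2 hst)]
    exact hmild s t hst ht y
  exact analyticOnNhd_slice hcont hbdd hmild' ht

end ExtremiserLiouville

end Summit.NavierStokesRegularity.NavierStokesRegularity.Theorems

end
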